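import Summits.HubbardSuperconductivity.HubbardSuperconductivity.Theorems.BalabanIRBirBdGPhaseCoercivityModes
import HarnessLib

/-!
# Crux `BirBdGPhaseCoercivity` (stmt-HubbardSuperconductivity-2081, route `BalabanIR`), line
`bcs-dual-persistence` (reshaped, `V := K`) — stub `stub_pairModes` (S5, the pair-fluctuation double sum
mode by mode)

If `D^_{kk'} = ½ N⁻¹ û(k'-k) (Δ_k + Δ_{k'})` (plane-wave matrix elements of the bond pairing block,
`BirBdG.hat_pairing_apply`) then, substituting `k' = k + q`,
`Σ_{k,k'} |D^_{kk'}|²/(E_k + E_{k'}) = ¼ N⁻² Σ_q |û(q)|² Σ_k |Δ_k + Δ_{k+q}|²/(E_k + E_{k+q})`.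
(Compare `BirBdG.sum_pairingHat_normSq_eq_modes`, which does the symmetrised `1/E_k` version; here the
weight `1/(E_k+E_{k'})` is already symmetric and one reindexing `Equiv.addLeft k` suffices.)
No definition is introduced. [folklore]
-/

noncomputable section

set_option linter.dupNamespace false

namespace Summit.HubbardSuperconductivity.HubbardSuperconductivity.Theorems.BirBdGPhaseCoercivity

open Matrix Finset Literature.Probability.LatticeModels
open Summit.HubbardSuperconductivity.HubbardSuperconductivity.Theorems.BirBdG
open scoped ComplexConjugate ComplexOrder

/-- **The pair-fluctuation double sum, mode by mode**: with `D^_{kk'} = ½ N⁻¹ û(k'-k)(Δ_k + Δ_{k'})`,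
`Σ_{k,k'} |D^_{kk'}|²/(E_k+E_{k'}) = ¼ N⁻² Σ_q |û(q)|² Σ_k |Δ_k+Δ_{k+q}|²/(E_k+E_{k+q})`. [folklore] -/
theorem stub_pairModes {d L : ℕ} [NeZero L] (N : ℝ) (uh : TorusSite d L → ℂ) (Δ : TorusSite d L → ℂ)
    (E : TorusSite d L → ℝ) (Dh : Matrix (TorusSite d L) (TorusSite d L) ℂ)
    (hDh : ∀ k k', Dh k k' = (1 / 2 : ℂ) * ((N : ℂ)⁻¹ * uh (k' - k)) * (Δ k + Δ k')) :
    ∑ k, ∑ k', ‖Dh k k'‖ ^ 2 / (E k + E k') =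
      (1 / 4) * N⁻¹ ^ 2 * ∑ q, ‖uh q‖ ^ 2 * ∑ k, ‖Δ k + Δ (k + q)‖ ^ 2 / (E k + E (k + q)) := by
  -- adapted from `BirBdG.sum_pairingHat_normSq_eq_modes` (Theorems/BalabanIRBirBdGPhaseCoercivityModes)
  have hnorm : ∀ k k', ‖Dh k k'‖ ^ 2 =
      (1 / 4) * N⁻¹ ^ 2 * (‖uh (k' - k)‖ ^ 2 * ‖Δ k + Δ k'‖ ^ 2) := by
    intro k k'
    rw [hDh, norm_mul, norm_mul, norm_mul, norm_inv, Complex.norm_real, Real.norm_eq_abs,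
      mul_pow, mul_pow, mul_pow, inv_pow, sq_abs]
    norm_num
    ring
  have hinner : ∀ k, ∑ k', ‖Dh k k'‖ ^ 2 / (E k + E k') =
      ∑ q, (1 / 4) * N⁻¹ ^ 2 * (‖uh q‖ ^ 2 * (‖Δ k + Δ (k + q)‖ ^ 2 / (E k + E (k + q)))) := by
    intro k
    rw [← Equiv.sum_comp (Equiv.addLeft k)]
    refine Finset.sum_congr rfl fun q _ => ?_
    simp only [Equiv.coe_addLeft, hnorm, add_sub_cancel_left]
    ring
  simp_rw [hinner]
  rw [Finset.sum_comm]
  simp_rw [← Finset.mul_sum]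

end Summit.HubbardSuperconductivity.HubbardSuperconductivity.Theorems.BirBdGPhaseCoercivity

end
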